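import Mathlib
import HarnessLib

/-!
# Cayley's theorem for semigroups; regular and inverse semigroups

Source: O. Ganyushkin, V. Mazorchuk, *Classical Finite Transformation Semigroups*, Algebra and
Applications 9, Springer (2009) [GanyushkinMazorchuk2009], §2.4 Theorem 2.4.3 (Cayley's
theorem), §2.6 (pairs of inverse elements, Exercise 2.6.1, Exercise 2.6.8), §2.7 Theorem 2.7.6,
and Exercise 2.10.12.

All notions are spelled out (no definitions): `a` and `b` are a *pair of inverse elements* if
`aba = a` and `bab = b`; a semigroup is *regular* if every `a` has some `b` with `aba = a`, and
*inverse* if every `a` has exactly one inverse element.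

* Theorem 2.4.3 (Cayley): every semigroup `S` embeds into the full transformation monoid of
  `S¹` (Mathlib `WithOne S`) by left translations, and a monoid into that of itself
  (`cayley_semigroup`, `cayley_monoid`);
* Exercise 2.6.1: an invertible element of a monoid has exactly one inverse element, `a⁻¹`
  (`inversePair_unit_iff`);
* Theorem 2.7.6: a regular semigroup is inverse iff its idempotents commute
  (`inverse_iff_idempotents_commute`; the two directions `existsUnique_inverse_of_commute`,
  `idempotents_commute_of_existsUnique_inverse`);
* Exercise 2.6.8: in an inverse semigroup `(a⁻¹)⁻¹ = a` and `(ab)⁻¹ = b⁻¹a⁻¹`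
  (`inversePair_symm`, `inversePair_mul`);
* Exercise 2.10.12: a regular semigroup with exactly one idempotent is a group
  (`group_of_regular_of_unique_idempotent`).
-/

namespace Literature.Algebra.Semigroups

/-! ### Theorem 2.4.3: Cayley's theorem -/

/-- **Theorem 2.4.3** (Cayley's theorem for semigroups): every semigroup `S` is isomorphic to
a subsemigroup of the full transformation monoid `𝒯(S¹)` — the map sending `a` to the left
translation `x ↦ ax` of `S¹ = WithOne S` is an injective multiplicative map into
`Function.End (WithOne S)`.  (For `|S| = n` this is the embedding into `𝒯ₙ₊₁`.)
[cite: GanyushkinMazorchuk2009, Theorem 2.4.3] -/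
theorem cayley_semigroup (S : Type*) [Semigroup S] :
    ∃ φ : S → Function.End (WithOne S),
      Function.Injective φ ∧ ∀ a b : S, φ (a * b) = φ a * φ b := by
  let φ : S → Function.End (WithOne S) := fun a x => (a : WithOne S) * x
  refine ⟨φ, fun a b h => ?_, fun a b => funext fun x => ?_⟩
  · have h1 : φ a 1 = φ b 1 := by rw [h]
    have h2 : (a : WithOne S) = (b : WithOne S) := by simpa [φ] using h1
    exact WithOne.coe_inj.1 h2
  · show ((a * b : S) : WithOne S) * x = (a : WithOne S) * ((b : WithOne S) * x)
    rw [WithOne.coe_mul, mul_assoc]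

/-- **Theorem 2.4.3** (Cayley's theorem, monoid case): a monoid `S` is isomorphic to a
submonoid of `𝒯(S)` via left translations (for `|S| = n`, an embedding into `𝒯ₙ`).
[cite: GanyushkinMazorchuk2009, Theorem 2.4.3] -/
theorem cayley_monoid (S : Type*) [Monoid S] :
    ∃ φ : S → Function.End S,
      Function.Injective φ ∧ φ 1 = 1 ∧ ∀ a b : S, φ (a * b) = φ a * φ b := by
  let φ : S → Function.End S := fun a x => a * x
  refine ⟨φ, fun a b h => ?_, funext fun x => one_mul x, fun a b => funext fun x => mul_assoc a b x⟩
  have h1 : φ a 1 = φ b 1 := by rw [h]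
  simpa [φ] using h1

/-! ### §2.6: inverse elements -/

/-- **Exercise 2.6.1**: for an invertible element `a` of a monoid, `V(a) = {a⁻¹}` — `b` is an
inverse element of `a` (`aba = a`, `bab = b`) iff `b = a⁻¹`.
[cite: GanyushkinMazorchuk2009, Exercise 2.6.1] -/
theorem inversePair_unit_iff {S : Type*} [Monoid S] (a : Sˣ) (b : S) :
    ((a : S) * b * a = a ∧ b * a * b = b) ↔ b = ↑a⁻¹ := by
  constructor
  · rintro ⟨h1, -⟩
    have := congrArg (fun x => (↑a⁻¹ : S) * x * ↑a⁻¹) h1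
    simpa [mul_assoc] using this
  · rintro rfl
    simp

/-- Pairs of inverse elements are symmetric: if `b ∈ V(a)` then `a ∈ V(b)`; in an inverse
semigroup this reads `(a⁻¹)⁻¹ = a` (**Exercise 2.6.8 (a)**).
[cite: GanyushkinMazorchuk2009, Exercise 2.6.8 (a)] -/
theorem inversePair_symm {S : Type*} [Semigroup S] {a b : S}
    (h : a * b * a = a ∧ b * a * b = b) : b * a * b = b ∧ a * b * a = a :=
  ⟨h.2, h.1⟩

/-! ### Theorem 2.7.6 -/

/-- **Theorem 2.7.6**, "if" direction: in a semigroup whose idempotents commute, every element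
has at most one inverse element (computation `b₁ = b₁ab₁ = ⋯ = b₂` of the printed proof); with
regularity (Proposition 2.6.2) it has exactly one.
[cite: GanyushkinMazorchuk2009, Theorem 2.7.6] -/
theorem inverse_unique_of_commute {S : Type*} [Semigroup S]
    (hc : ∀ e f : S, e * e = e → f * f = f → e * f = f * e) {a b₁ b₂ : S}
    (h₁ : a * b₁ * a = a ∧ b₁ * a * b₁ = b₁) (h₂ : a * b₂ * a = a ∧ b₂ * a * b₂ = b₂) :
    b₁ = b₂ := by
  -- the idempotents `ab₁, ab₂, b₁a, b₂a`
  have e1 : (a * b₁) * (a * b₁) = a * b₁ := by rw [← mul_assoc, h₁.1]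
  have e2 : (a * b₂) * (a * b₂) = a * b₂ := by rw [← mul_assoc, h₂.1]
  have e3 : (b₁ * a) * (b₁ * a) = b₁ * a := by rw [mul_assoc, ← mul_assoc a, h₁.1]
  have e4 : (b₂ * a) * (b₂ * a) = b₂ * a := by rw [mul_assoc, ← mul_assoc a, h₂.1]
  calc b₁ = b₁ * a * b₁ := h₁.2.symm
    _ = b₁ * (a * b₂ * a) * b₁ := by rw [h₂.1]
    _ = b₁ * ((a * b₂) * (a * b₁)) := by simp only [mul_assoc]
    _ = b₁ * ((a * b₁) * (a * b₂)) := by rw [hc _ _ e2 e1]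
    _ = (b₁ * a * b₁) * a * b₂ := by simp only [mul_assoc]
    _ = b₁ * a * b₂ := by rw [h₁.2]
    _ = b₁ * (a * b₂ * a) * b₂ := by rw [h₂.1]
    _ = (b₁ * a) * (b₂ * a) * b₂ := by simp only [mul_assoc]
    _ = (b₂ * a) * (b₁ * a) * b₂ := by rw [hc _ _ e3 e4]
    _ = b₂ * (a * b₁ * a) * b₂ := by simp only [mul_assoc]
    _ = b₂ := by rw [h₁.1, h₂.2]

/-- **Theorem 2.7.6**, "if" direction: a regular semigroup whose idempotents commute is an
inverse semigroup. [cite: GanyushkinMazorchuk2009, Theorem 2.7.6] -/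
theorem existsUnique_inverse_of_commute {S : Type*} [Semigroup S]
    (hreg : ∀ a : S, ∃ b, a * b * a = a)
    (hc : ∀ e f : S, e * e = e → f * f = f → e * f = f * e) (a : S) :
    ∃! b, a * b * a = a ∧ b * a * b = b := by
  obtain ⟨b, hb⟩ := hreg a
  -- Proposition 2.6.2: `bab` is an inverse of `a`
  refine ⟨b * a * b, ⟨?_, ?_⟩, fun c hc' => inverse_unique_of_commute hc hc' ⟨?_, ?_⟩⟩
  all_goals first
    | (calc a * (b * a * b) * a = (a * b * a) * b * a := by simp only [mul_assoc]
          _ = a := by rw [hb, hb])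
    | (calc b * a * b * a * (b * a * b) = b * (a * b * a) * (b * a * b) := by simp only [mul_assoc]
          _ = b * a * (b * a * b) := by rw [hb]
          _ = b * (a * b * a) * b := by simp only [mul_assoc]
          _ = b * a * b := by rw [hb])

/-- **Theorem 2.7.6**, "only if" direction: in an inverse semigroup (every element has exactly
one inverse element) any two idempotents commute — following the printed proof through
`a = (ef)⁻¹`, `ae = a = fa`, `a² = a`, `ef = a`, and `(ef)⁻¹ = fe`.
[cite: GanyushkinMazorchuk2009, Theorem 2.7.6] -/
theorem idempotents_commute_of_existsUnique_inverse {S : Type*} [Semigroup S]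
    (hinv : ∀ a : S, ∃! b, a * b * a = a ∧ b * a * b = b) :
    ∀ e f : S, e * e = e → f * f = f → e * f = f * e := by
  -- uniqueness of inverses as a function
  have huniq : ∀ {a b c : S}, (a * b * a = a ∧ b * a * b = b) → (a * c * a = a ∧ c * a * c = c) →
      b = c := fun {a b c} hb hc => (hinv a).unique hb hc
  -- Step 1: the product of two idempotents is an idempotent
  have step : ∀ e f : S, e * e = e → f * f = f → (e * f) * (e * f) = e * f := by
    intro e f he hf
    obtain ⟨a, ⟨h1, h2⟩, -⟩ := hinv (e * f)
    -- `ae` is also an inverse of `ef`, hence `ae = a`; similarly `fa = a`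
    have hae : a * e = a := by
      refine (huniq ⟨?_, ?_⟩ ⟨h1, h2⟩)
      · calc e * f * (a * e) * (e * f) = e * f * a * ((e * e) * f) := by simp only [mul_assoc]
          _ = e * f := by rw [he, h1]
      · calc a * e * (e * f) * (a * e) = a * ((e * e) * f) * a * e := by simp only [mul_assoc]
          _ = a * e := by rw [he, h2]
    have hfa : f * a = a := by
      refine (huniq ⟨?_, ?_⟩ ⟨h1, h2⟩)
      · calc e * f * (f * a) * (e * f) = e * (f * f) * a * (e * f) := by simp only [mul_assoc]
          _ = e * f := by rw [hf, h1]
      · calc f * a * (e * f) * (f * a) = f * (a * (e * (f * f)) * a) := by simp only [mul_assoc]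
          _ = f * a := by rw [hf, h2]
    -- `a` is an idempotent
    have haa : a * a = a := by
      calc a * a = (a * e) * (f * a) := by rw [hae, hfa]
        _ = a * (e * f) * a := by simp only [mul_assoc]
        _ = a := h2
    -- `ef` and `a` are both inverses of `a`, so `ef = a`
    have hefa : e * f = a := huniq ⟨h2, h1⟩ ⟨by rw [haa, haa], by rw [haa, haa]⟩
    rw [hefa, haa]
  -- Step 2: `fe` is an inverse of the idempotent `ef`, which is its own inverse
  intro e f he hf
  have hef := step e f he hf
  have hfe := step f e hf he
  have h1 : e * f * (f * e) * (e * f) = e * f := by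
    calc e * f * (f * e) * (e * f) = e * (f * f) * (e * e) * f := by simp only [mul_assoc]
      _ = (e * f) * (e * f) := by rw [hf, he]; simp only [mul_assoc]
      _ = e * f := hef
  have h2 : f * e * (e * f) * (f * e) = f * e := by
    calc f * e * (e * f) * (f * e) = f * (e * e) * (f * f) * e := by simp only [mul_assoc]
      _ = (f * e) * (f * e) := by rw [he, hf]; simp only [mul_assoc]
      _ = f * e := hfe
  exact huniq ⟨by rw [hef, hef], by rw [hef, hef]⟩ ⟨h1, h2⟩

/-- **Theorem 2.7.6**: a regular semigroup is inverse iff all of its idempotents commute.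
[cite: GanyushkinMazorchuk2009, Theorem 2.7.6] -/
theorem inverse_iff_idempotents_commute {S : Type*} [Semigroup S]
    (hreg : ∀ a : S, ∃ b, a * b * a = a) :
    (∀ a : S, ∃! b, a * b * a = a ∧ b * a * b = b) ↔
      ∀ e f : S, e * e = e → f * f = f → e * f = f * e :=
  ⟨idempotents_commute_of_existsUnique_inverse, fun hc => existsUnique_inverse_of_commute hreg hc⟩

/-- **Exercise 2.6.8 (b)**: in an inverse semigroup `(ab)⁻¹ = b⁻¹a⁻¹` — if `a'`, `b'` are the
inverse elements of `a`, `b`, then `b'a'` is the inverse element of `ab`.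
[cite: GanyushkinMazorchuk2009, Exercise 2.6.8 (b)] -/
theorem inversePair_mul {S : Type*} [Semigroup S]
    (hinv : ∀ a : S, ∃! b, a * b * a = a ∧ b * a * b = b) {a a' b b' : S}
    (ha : a * a' * a = a ∧ a' * a * a' = a') (hb : b * b' * b = b ∧ b' * b * b' = b') :
    (a * b) * (b' * a') * (a * b) = a * b ∧ (b' * a') * (a * b) * (b' * a') = b' * a' := by
  have hc := idempotents_commute_of_existsUnique_inverse hinv
  -- the idempotents `a'a` and `bb'` commute
  have e1 : (a' * a) * (a' * a) = a' * a := by rw [mul_assoc, ← mul_assoc a, ha.1]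
  have e2 : (b * b') * (b * b') = b * b' := by rw [← mul_assoc, hb.1]
  have hcomm : (a' * a) * (b * b') = (b * b') * (a' * a) := hc _ _ e1 e2
  constructor
  · calc a * b * (b' * a') * (a * b) = a * ((b * b') * (a' * a)) * b := by simp only [mul_assoc]
      _ = a * ((a' * a) * (b * b')) * b := by rw [hcomm]
      _ = (a * a' * a) * (b * b' * b) := by simp only [mul_assoc]
      _ = a * b := by rw [ha.1, hb.1]
  · calc b' * a' * (a * b) * (b' * a') = b' * ((a' * a) * (b * b')) * a' := by simp only [mul_assoc]
      _ = b' * ((b * b') * (a' * a)) * a' := by rw [hcomm]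
      _ = (b' * b * b') * (a' * a * a') := by simp only [mul_assoc]
      _ = b' * a' := by rw [hb.2, ha.2]

/-! ### Exercise 2.10.12 -/

/-- **Exercise 2.10.12**: a regular semigroup with exactly one idempotent `e` (every
idempotent equals `e`; `e` itself is then idempotent, being `ab` for `aba = a`) is a group —
`e` is a two-sided identity and every element has a two-sided inverse with respect to `e`.
[cite: GanyushkinMazorchuk2009, Exercise 2.10.12] -/
theorem group_of_regular_of_unique_idempotent {S : Type*} [Semigroup S]
    (hreg : ∀ a : S, ∃ b, a * b * a = a) {e : S}
    (huniq : ∀ f : S, f * f = f → f = e) (a : S) :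
    (e * a = a ∧ a * e = a) ∧ ∃ b, a * b = e ∧ b * a = e := by
  obtain ⟨b, hb⟩ := hreg a
  -- `ab` and `ba` are idempotents, hence both equal `e`
  have hab : a * b = e := huniq _ (by rw [← mul_assoc, hb])
  have hba : b * a = e := huniq _ (by rw [mul_assoc, ← mul_assoc a, hb])
  refine ⟨⟨?_, ?_⟩, b, hab, hba⟩
  · rw [← hab, hb]
  · rw [← hba, ← mul_assoc, hb]

end Literature.Algebra.Semigroups
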